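import Mathlib
import Literature.RingTheory.MvPowerSeries.FrobeniusPowerBasis

/-!
# `WeightedInvariant.LocalWeightedDrop`, sub-stub N4″: vertex persistence under re-centring in characteristic 2 (piece T-4 = L4/H16′)

Crux item stmt-ResolutionOfSingularities-8899 `LocalWeightedDrop` (route `ResolutionOfSingularities/WeightedInvariant`), door
`WeightedConstruction` stmt-ResolutionOfSingularities-0571.  [OURS · L1 W4.3, chain w43, lead prover; piece T-4 of the N4″ plan
(`N4PRIME-PLAN.md`, evidence on stmt-8899).  The MODEL is Hironaka's vertex theorem (Cossart–Jannsen–Saito LNM 2270 Thm 8.16 = [H3]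
Thm (4.8): "a vertex at which `(f, y, u)` is prepared is a vertex of `Δ(J, u)`") in the one situation the descent game needs it: a monic
double point `y² + A₁y + A₀`, `A₀, A₁ ∈ k[[u]]`, `char k = 2`, re-centrings `y ↦ y + ψ(u)`.  Statements and proofs here are OURS and
elementary; nothing is attributed to the manuscript.]

In characteristic `2` a re-centring acts by `(A₀, A₁) ↦ (A₀ + A₁ψ + ψ², A₁)` and `ψ² = Σ ψ_d² u^{2d}` has only EVEN exponents
(`Literature.RingTheory.MvPowerSeries.coeff_smul_pow_pow` / `isSupportedOnMultiples_pow`).  Consequently an exponent `e` of `A₀` with an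
ODD coordinate which is minimal for a weight `w` among the exponents of `A₀`, and below twice the `w`-weights of the exponents of `A₁`
(i.e. the point `e` of the scaled Newton set `N = supp A₀ ∪ 2·supp A₁` is `w`-minimal and "odd"), can never be dissolved:

* `MonicDescent.exists_low_exponent_of_recentre` — for EVERY `ψ`, `A₀ + A₁ψ + ψ²` has an exponent of `w`-weight `≤ w·e`
  (three cases on the least `w`-weight `ω` of `ψ`: `2ω < w·e` — the square `ψ_{d₀}² u^{2d₀}` survives; otherwise the monomial `u^e` itself
  survives, because `A₁ψ` only produces weights `> w·e` and `ψ²` only even exponents);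
* `MonicDescent.exists_low_row_of_recentre` / `exists_low_col_of_recentre` — the ROW/COLUMN TRANSFER used by the strategy Σ** of the plan
  (corollary with `w = (1, L)`, `L ≫ 0`): if the lowest row (resp. leftmost column) of the scaled Newton set of a pair over `k[[u₁,u₂]]`
  reaches height `≤ 1` at an odd point that is lexicographically minimal, then NO re-centring makes `V(y, u₂)` (resp. `V(y, u₁)`) permissible
  (`u₂ ∣ A₁ ∧ u₂² ∣ A₀ + A₁ψ + ψ²` fails for all `ψ`).
-/

set_option linter.dupNamespace false -- mandated namespace of this single-conjunct summit

namespace Summit.ResolutionOfSingularities.ResolutionOfSingularities.Theorems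

namespace MonicDescent

open MvPowerSeries Literature.RingTheory.MvPowerSeries

variable {k : Type} [Field k] [CharP k 2] {σ : Type}

/-- In characteristic `2`, `ψ²` has no coefficient at an exponent with an odd coordinate. -/
theorem coeff_sq_eq_zero_of_odd (ψ : MvPowerSeries σ k) {e : σ →₀ ℕ} (he : ∃ i, ¬ 2 ∣ e i) :
    coeff e (ψ ^ 2) = 0 := by
  haveI : ExpChar k 2 := ExpChar.prime Nat.prime_two
  have h := isSupportedOnMultiples_pow (R := k) 2 ψ 1
  rw [pow_one] at h
  exact h e he

/-- In characteristic `2`, the coefficient of `ψ²` at `2d` is `ψ_d²`. -/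
theorem coeff_two_smul_sq (ψ : MvPowerSeries σ k) (d : σ →₀ ℕ) :
    coeff (2 • d) (ψ ^ 2) = (coeff d ψ) ^ 2 := by
  haveI : ExpChar k 2 := ExpChar.prime Nat.prime_two
  have h := coeff_smul_pow_pow (R := k) 2 ψ 1 d
  simpa using h

omit [CharP k 2] in
/-- A coefficient of a product vanishes if no pair of non-zero coefficients has exponents summing to the index. -/
theorem coeff_mul_eq_zero_of_forall {A B : MvPowerSeries σ k} {e : σ →₀ ℕ}
    (h : ∀ a d : σ →₀ ℕ, a + d = e → coeff a A ≠ 0 → coeff d B ≠ 0 → False) :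
    coeff e (A * B) = 0 := by
  classical
  rw [coeff_mul]
  refine Finset.sum_eq_zero fun x hx => ?_
  rw [Finset.HasAntidiagonal.mem_antidiagonal] at hx
  by_cases ha : coeff x.1 A = 0
  · rw [ha, zero_mul]
  by_cases hb : coeff x.2 B = 0
  · rw [hb, mul_zero]
  exact (h x.1 x.2 hx ha hb).elim

/-- VERTEX PERSISTENCE UNDER RE-CENTRING (characteristic 2).  Let `w` be any weight, `e` an exponent of `A₀` (`(A₀)_e ≠ 0`) with an
odd coordinate, of minimal `w`-weight among the exponents of `A₀` and of `w`-weight `< 2·w(a)` for every exponent `a` of `A₁` (the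
point `e` of the scaled Newton set `supp A₀ ∪ 2·supp A₁` is `w`-minimal and odd — "prepared at `e`").  Then for EVERY re-centring `ψ`
the series `A₀ + A₁ψ + ψ²` has an exponent of `w`-weight `≤ w(e)`.  (Char-`2` double-point case of CJS LNM 2270 Thm 8.16.) -/
theorem exists_low_exponent_of_recentre (w : σ → ℕ) (A₀ A₁ ψ : MvPowerSeries σ k) (e : σ →₀ ℕ)
    (he : coeff e A₀ ≠ 0) (hodd : ∃ i, ¬ 2 ∣ e i)
    (hmin₀ : ∀ d, coeff d A₀ ≠ 0 → Finsupp.weight w e ≤ Finsupp.weight w d)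
    (hmin₁ : ∀ a, coeff a A₁ ≠ 0 → Finsupp.weight w e < 2 * Finsupp.weight w a) :
    ∃ d, coeff d (A₀ + A₁ * ψ + ψ ^ 2) ≠ 0 ∧ Finsupp.weight w d ≤ Finsupp.weight w e := by
  classical
  by_cases hlow : ∃ d, coeff d ψ ≠ 0 ∧ 2 * Finsupp.weight w d < Finsupp.weight w e
  · -- the least `w`-weight `ω` of `ψ` satisfies `2ω < w(e)`; the square of the lowest part of `ψ` survives
    have hex : ∃ n, ∃ d, coeff d ψ ≠ 0 ∧ Finsupp.weight w d = n := by
      obtain ⟨d, hd, -⟩ := hlow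
      exact ⟨_, d, hd, rfl⟩
    obtain ⟨d₀, hd₀, hd₀w⟩ := Nat.find_spec hex
    have hωmin : ∀ d, coeff d ψ ≠ 0 → Finsupp.weight w d₀ ≤ Finsupp.weight w d := by
      intro d hd
      rw [hd₀w]
      exact Nat.find_min' hex ⟨d, hd, rfl⟩
    have h2ω : 2 * Finsupp.weight w d₀ < Finsupp.weight w e := by
      obtain ⟨d, hd, hlt⟩ := hlow
      exact lt_of_le_of_lt (Nat.mul_le_mul_left 2 (hωmin d hd)) hlt
    refine ⟨2 • d₀, ?_, ?_⟩
    · have hA₀ : coeff (2 • d₀) A₀ = 0 := by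
        by_contra hne
        have := hmin₀ _ hne
        rw [map_nsmul, smul_eq_mul] at this
        omega
      have hA₁ : coeff (2 • d₀) (A₁ * ψ) = 0 := by
        refine coeff_mul_eq_zero_of_forall fun a d had ha hd => ?_
        have h1 := hmin₁ a ha
        have h2 := hωmin d hd
        have h3 : Finsupp.weight w a + Finsupp.weight w d = 2 * Finsupp.weight w d₀ := by
          rw [← map_add, had, map_nsmul, smul_eq_mul]
        omega
      rw [map_add, map_add, hA₀, hA₁, zero_add, zero_add, coeff_two_smul_sq]
      exact pow_ne_zero 2 hd₀
    · rw [map_nsmul, smul_eq_mul]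
      exact h2ω.le
  · -- every exponent of `ψ` has `2 w(d) ≥ w(e)`: the odd monomial `u^e` survives
    push Not at hlow
    refine ⟨e, ?_, le_rfl⟩
    have hA₁ : coeff e (A₁ * ψ) = 0 := by
      refine coeff_mul_eq_zero_of_forall fun a d had ha hd => ?_
      have h1 := hmin₁ a ha
      have h2 := hlow d hd
      have h3 : Finsupp.weight w a + Finsupp.weight w d = Finsupp.weight w e := by
        rw [← map_add, had]
      omega
    rw [map_add, map_add, hA₁, coeff_sq_eq_zero_of_odd ψ hodd, add_zero, add_zero]
    exact he

/-- ROW TRANSFER (corollary, `σ = Fin 2`, weight `(1, L)` with `L ≫ 0`).  Suppose the scaled Newton set of `(A₀, A₁)` has an ODD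
lexicographically-lowest point on a row of height `≤ 1`: an exponent `e` of `A₀` with an odd coordinate and `e 1 ≤ 1`, such that every
exponent `d` of `A₀` has `e 1 < d 1 ∨ (e 1 = d 1 ∧ e 0 ≤ d 0)` and every exponent `a` of `A₁` has `e 1 < 2 a 1 ∨ (e 1 = 2 a 1 ∧ e 0 < 2 a 0)`.
Then after ANY re-centring `A₀ + A₁ψ + ψ²` still has an exponent of height `≤ 1`; in particular `u₂² ∤ A₀ + A₁ψ + ψ²`, so no
re-centring makes the curve `V(y, u₂)` permissible.  (In the plan: a well-prepared label with `ε ≤ 1` stays so — the "(a″)" test and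
the tail argument.) -/
theorem exists_low_row_of_recentre (A₀ A₁ ψ : MvPowerSeries (Fin 2) k) (e : Fin 2 →₀ ℕ)
    (he : coeff e A₀ ≠ 0) (hodd : ∃ i, ¬ 2 ∣ e i) (hrow : e 1 ≤ 1)
    (hmin₀ : ∀ d, coeff d A₀ ≠ 0 → e 1 < d 1 ∨ (e 1 = d 1 ∧ e 0 ≤ d 0))
    (hmin₁ : ∀ a, coeff a A₁ ≠ 0 → e 1 < 2 * a 1 ∨ (e 1 = 2 * a 1 ∧ e 0 < 2 * a 0)) :
    ∃ d, coeff d (A₀ + A₁ * ψ + ψ ^ 2) ≠ 0 ∧ d 1 ≤ 1 := by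
  set L : ℕ := e 0 + 1 with hL
  set w : Fin 2 → ℕ := fun j => if j = 1 then L else 1 with hw
  have hweight : ∀ d : Fin 2 →₀ ℕ, Finsupp.weight w d = d 0 + L * d 1 := by
    intro d
    rw [Finsupp.weight_apply, Finsupp.sum_fintype _ _ (by simp)]
    simp [Fin.sum_univ_two, hw]
    ring
  obtain ⟨d, hd, hle⟩ := exists_low_exponent_of_recentre w A₀ A₁ ψ e he hodd
    (fun d hd => by
      rw [hweight, hweight]
      rcases hmin₀ d hd with h | ⟨h1, h0⟩
      · nlinarith
      · rw [h1]; omega)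
    (fun a ha => by
      rw [hweight, hweight]
      rcases hmin₁ a ha with h | ⟨h1, h0⟩
      · nlinarith
      · nlinarith)
  refine ⟨d, hd, ?_⟩
  rw [hweight, hweight] at hle
  by_contra hlt
  push Not at hlt
  nlinarith

/-- COLUMN TRANSFER: the same with the roles of `u₁`, `u₂` exchanged (weight `(L, 1)`): an odd lexicographically-leftmost point of the
scaled Newton set in a column `≤ 1` survives every re-centring, so no re-centring makes `V(y, u₁)` permissible. -/
theorem exists_low_col_of_recentre (A₀ A₁ ψ : MvPowerSeries (Fin 2) k) (e : Fin 2 →₀ ℕ)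
    (he : coeff e A₀ ≠ 0) (hodd : ∃ i, ¬ 2 ∣ e i) (hcol : e 0 ≤ 1)
    (hmin₀ : ∀ d, coeff d A₀ ≠ 0 → e 0 < d 0 ∨ (e 0 = d 0 ∧ e 1 ≤ d 1))
    (hmin₁ : ∀ a, coeff a A₁ ≠ 0 → e 0 < 2 * a 0 ∨ (e 0 = 2 * a 0 ∧ e 1 < 2 * a 1)) :
    ∃ d, coeff d (A₀ + A₁ * ψ + ψ ^ 2) ≠ 0 ∧ d 0 ≤ 1 := by
  set L : ℕ := e 1 + 1 with hL
  set w : Fin 2 → ℕ := fun j => if j = 0 then L else 1 with hw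
  have hweight : ∀ d : Fin 2 →₀ ℕ, Finsupp.weight w d = L * d 0 + d 1 := by
    intro d
    rw [Finsupp.weight_apply, Finsupp.sum_fintype _ _ (by simp)]
    simp [Fin.sum_univ_two, hw]
    ring
  obtain ⟨d, hd, hle⟩ := exists_low_exponent_of_recentre w A₀ A₁ ψ e he hodd
    (fun d hd => by
      rw [hweight, hweight]
      rcases hmin₀ d hd with h | ⟨h0, h1⟩
      · nlinarith
      · rw [h0]; omega)
    (fun a ha => by
      rw [hweight, hweight]
      rcases hmin₁ a ha with h | ⟨h0, h1⟩
      · nlinarith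
      · nlinarith)
  refine ⟨d, hd, ?_⟩
  rw [hweight, hweight] at hle
  by_contra hlt
  push Not at hlt
  nlinarith

end MonicDescent

end Summit.ResolutionOfSingularities.ResolutionOfSingularities.Theorems
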